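import Summits.ResolutionOfSingularities.ResolutionOfSingularities.Theorems.WeightedInvariantTerminatingCentreDatum
import HarnessLib

/-!
# Terminating weighted-centre data — the `inv`-free normal form `CentreRankDatum`

Sibling of `Theorems/WeightedInvariantTerminatingCentreDatum.lean` (route `ResolutionOfSingularities/WeightedInvariant`,
repair planner `res-wc-repair-plan-1`, TURNKEY step 1; director-resolution ruling 2026-08-27T02:14:20Z (3)),
split off from that def-module ONLY because Theorems files with proofs are capped at 400 lines; the
declarations below are byte-identical to the planner's file of record (sha16 4a2fc95324fe42af, lines 321–454).
DEFINITIONS + two conversions, import cycle-free (does NOT import the route file).  Nothing is asserted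
about Hironaka's problem; no `Nonempty` of anything is claimed.

* `CentreRankDatum p` — the `inv`-free normal form of `TerminatingCentreDatum p`: only a centre and a rank
  of pairs; the guard is "`V(X)` is not regular".
* `CentreRankDatum.singRating`, `isBot_singRating_iff`, `exists_not_isBot_singRating_iff` — the `Bool`
  rating detecting the non-regular locus.
* `CentreRankDatum.toTerminating` / `TerminatingCentreDatum.toCentreRank` — the two conversions (the rating
  `inv` of the relaxed interface carries no content beyond the singular locus of `X`).
-/

noncomputable section

open CategoryTheory AlgebraicGeometry TopologicalSpace
open Literature.AlgebraicGeometry.Resolution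

set_option linter.dupNamespace false -- mandated namespace of this single-conjunct summit

namespace Summit.ResolutionOfSingularities.ResolutionOfSingularities.Theorems

/-! ## The `inv`-free normal form -/

/-- **Centre-and-rank datum in characteristic `p`** — the `inv`-free normal form of
`TerminatingCentreDatum p`: only a centre and a rank of pairs; the guard is "`V(X)` is not regular"
and `(iii-b′)` reads "the centre lies in the image of the non-regular locus of `V(X)`".  The two
conversions `TerminatingCentreDatum.toCentreRank` / `CentreRankDatum.toTerminating` show that the
rating `inv` of the relaxed interface carries no content beyond the singular locus. [folklore] -/
structure CentreRankDatum (p : ℕ) : Type 1 where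
  /-- the weighted centre of `(Y, X)` (total) -/
  centre : ∀ ⦃k : Type⦄ [Field k] ⦃Y : Scheme.{0}⦄, (Y ⟶ Spec (.of k)) → Y.IdealSheafData →
    ReesAlgebraData Y
  /-- the value set of the termination rank -/
  Λ : Type
  /-- `Λ` is linearly ordered … -/
  [linearOrderRank : LinearOrder Λ]
  /-- … and well-ordered -/
  [wellFoundedLTRank : WellFoundedLT Λ]
  /-- the termination rank of a PAIR (total) -/
  rank : ∀ ⦃k : Type⦄ [Field k] ⦃Y : Scheme.{0}⦄, (Y ⟶ Spec (.of k)) → Y.IdealSheafData → Λ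
  /-- `(iii-a)` [guard: `V(X)` not regular] the centre is a regular weighted centre -/
  isRegularWeightedCentre_centre : ∀ ⦃k : Type⦄ [Field k] [CharP k p] [PerfectField k]
    ⦃Y : Scheme.{0}⦄ (f : Y ⟶ Spec (.of k)) [Smooth f] [IsSeparated f] [QuasiCompact f]
    (X : Y.IdealSheafData), ¬ Scheme.IsRegular X.subscheme → (centre f X).IsRegularWeightedCentre
  /-- `(iii-b″)` [guard] the centre lies under the non-regular points of `V(X)` -/
  support_centre_subset : ∀ ⦃k : Type⦄ [Field k] [CharP k p] [PerfectField k]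
    ⦃Y : Scheme.{0}⦄ (f : Y ⟶ Spec (.of k)) [Smooth f] [IsSeparated f] [QuasiCompact f]
    (X : Y.IdealSheafData), ¬ Scheme.IsRegular X.subscheme →
    (centre f X).support ⊆ {y : Y | ∃ x : X.subscheme, X.subschemeι x = y ∧
      ¬ IsRegularLocalRing (X.subscheme.presheaf.stalk x)}
  /-- `(hom)` [guard] homogeneity of the centre on graded affine charts -/
  centre_isHomogeneous : ∀ ⦃k : Type⦄ [Field k] [CharP k p] [PerfectField k]
    ⦃Y : Scheme.{0}⦄ (f : Y ⟶ Spec (.of k)) [Smooth f] [IsSeparated f] [QuasiCompact f]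
    (X : Y.IdealSheafData), ¬ Scheme.IsRegular X.subscheme →
    ∀ (j : ℕ) (W : Y.affineOpens) (𝒜 : (Fin j → ℤ) → AddSubgroup Γ(Y, W)) [GradedRing 𝒜],
      (∀ c : Γ(Spec (.of k), ⊤), f.appLE ⊤ W le_top c ∈ 𝒜 0) →
      (X.ideal W).IsHomogeneous 𝒜 →
      ∀ n : ℕ, (((centre f X).piece n).ideal W).IsHomogeneous 𝒜
  /-- `(term)` [guard] the rank drops along the canonical successor -/
  rank_lt : ∀ ⦃k : Type⦄ [Field k] [CharP k p] [PerfectField k]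
    ⦃Y : Scheme.{0}⦄ (f : Y ⟶ Spec (.of k)) [Smooth f] [IsSeparated f] [QuasiCompact f]
    (X : Y.IdealSheafData), ¬ Scheme.IsRegular X.subscheme →
    ∀ (R' : ReesFiltration Y), R'.ideal = (centre f X).piece →
      rank (R'.πPlus ≫ f) (R'.strictTransformPlus X) < rank f X

namespace CentreRankDatum

variable {p : ℕ}

/-- The `Bool`-valued rating of the normal form: `true` exactly under the non-regular points of
`V(X)`. [folklore] -/
def singRating {Y : Scheme.{0}} (X : Y.IdealSheafData) (y : Y) : Bool :=
  haveI := Classical.propDecidable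
    (∃ x : X.subscheme, X.subschemeι x = y ∧ ¬ IsRegularLocalRing (X.subscheme.presheaf.stalk x))
  decide (∃ x : X.subscheme, X.subschemeι x = y ∧ ¬ IsRegularLocalRing (X.subscheme.presheaf.stalk x))

/-- `singRating` is minimal (`false`) at `y` iff `V(X)` is regular over `y`. [folklore] -/
theorem isBot_singRating_iff {Y : Scheme.{0}} (X : Y.IdealSheafData) (y : Y) :
    IsBot (singRating X y) ↔
      ∀ x : X.subscheme, X.subschemeι x = y → IsRegularLocalRing (X.subscheme.presheaf.stalk x) := by
  rw [isBot_iff_eq_bot, _root_.bot_eq_false, singRating, decide_eq_false_iff_not]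
  push Not
  rfl

/-- The guard of the normal form in terms of `singRating`. [folklore] -/
theorem exists_not_isBot_singRating_iff {Y : Scheme.{0}} (X : Y.IdealSheafData) :
    (∃ y : Y, ¬ IsBot (singRating X y)) ↔ ¬ Scheme.IsRegular X.subscheme := by
  constructor
  · rintro ⟨y, hy⟩ hreg
    exact hy ((isBot_singRating_iff X y).mpr fun x _ => hreg x)
  · intro h
    by_contra hcon
    push Not at hcon
    exact h fun x => (isBot_singRating_iff X _).mp (hcon (X.subschemeι x)) x rfl

/-- **Normal form ⇒ relaxed interface**: rate by `singRating` (`Γ := Bool`). [folklore] -/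
def toTerminating (F : CentreRankDatum p) : TerminatingCentreDatum p where
  Γ := Bool
  inv := fun _ _ _ _ X y => singRating X y
  centre := F.centre
  Λ := F.Λ
  linearOrderRank := F.linearOrderRank
  wellFoundedLTRank := F.wellFoundedLTRank
  rank := F.rank
  isBot_inv_iff := fun _ _ _ _ _ _ _ _ _ X y => isBot_singRating_iff X y
  isRegularWeightedCentre_centre := fun _ _ _ _ _ f _ _ _ X h =>
    F.isRegularWeightedCentre_centre f X ((exists_not_isBot_singRating_iff X).mp h)
  support_centre_subset := fun _ _ _ _ _ f _ _ _ X h y hy => by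
    have hy' := F.support_centre_subset f X ((exists_not_isBot_singRating_iff X).mp h) hy
    simp only [Set.mem_setOf_eq, isBot_singRating_iff]
    push Not
    exact hy'
  centre_isHomogeneous := fun _ _ _ _ _ f _ _ _ X h j W 𝒜 _ h0 hX n =>
    F.centre_isHomogeneous f X ((exists_not_isBot_singRating_iff X).mp h) j W 𝒜 h0 hX n
  rank_lt := fun _ _ _ _ _ f _ _ _ X h R' hR' =>
    F.rank_lt f X ((exists_not_isBot_singRating_iff X).mp h) R' hR'

end CentreRankDatum

namespace TerminatingCentreDatum

variable {p : ℕ}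

/-- **Relaxed interface ⇒ normal form**: forget the rating, keep its guard through `(ii)`. [folklore] -/
def toCentreRank (E : TerminatingCentreDatum p) : CentreRankDatum p where
  centre := E.centre
  Λ := E.Λ
  rank := E.rank
  isRegularWeightedCentre_centre := fun _ _ _ _ _ f _ _ _ X h => by
    refine E.isRegularWeightedCentre_centre f X ?_
    by_contra hcon
    push Not at hcon
    exact h ((E.forall_isBot_inv_iff f X).mp hcon)
  support_centre_subset := fun _ _ _ _ _ f _ _ _ X h y hy => by
    have hguard : ∃ y : _, ¬ IsBot (E.inv f X y) := by
      by_contra hcon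
      push Not at hcon
      exact h ((E.forall_isBot_inv_iff f X).mp hcon)
    have hy' := E.support_centre_subset f X hguard hy
    simp only [Set.mem_setOf_eq, E.isBot_inv_iff f X y] at hy'
    push Not at hy'
    exact hy'
  centre_isHomogeneous := fun _ _ _ _ _ f _ _ _ X h j W 𝒜 _ h0 hX n => by
    refine E.centre_isHomogeneous f X ?_ j W 𝒜 h0 hX n
    by_contra hcon
    push Not at hcon
    exact h ((E.forall_isBot_inv_iff f X).mp hcon)
  rank_lt := fun _ _ _ _ _ f _ _ _ X h R' hR' => by
    refine E.rank_lt f X ?_ R' hR'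
    by_contra hcon
    push Not at hcon
    exact h ((E.forall_isBot_inv_iff f X).mp hcon)

end TerminatingCentreDatum

end Summit.ResolutionOfSingularities.ResolutionOfSingularities.Theorems

end
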